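/-
Copyright (c) 2026. All rights reserved.
Released under Apache 2.0 license as described in the file LICENSE.
Authors: abc-iut cell, seat abc-iut-L4-t14 (gen 5; proof-only CODA, L4-lead m59/m69/m75: [AbsTopIII]
Prop 4.2 (i) «objects of EA mapping to X id-rigid» + Cor 4.5 at GENUINE bases by print's route
(uniformisation + Lemma 4.3) — the tripod ℙ¹ ∖ {0,1,∞} with ZERO hypotheses (both morphism classes),
every arithmetic base, and ℂ ∖ F, E ∖ {x₀} modulo `Aut` finiteness only).
-/
import Literature.AnabelianGeometry.AbsoluteAnabelian.ArchimedeanHolFieldFunctorGeometricRCPSLHfinFree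
import Literature.AnabelianGeometry.AbsoluteAnabelian.ArchimedeanHolFieldFunctorGeometricPSLGammaTwoUniformisation
import Literature.AnabelianGeometry.AbsoluteAnabelian.ArchimedeanHolFieldFunctorGeometricPSLArithmeticCusps
import Literature.AnabelianGeometry.AbsoluteAnabelian.ArchimedeanHolFieldFunctorGeometricPSLArithmeticHfin
import HarnessLib

/-!
# [AbsTopIII] Prop 4.2 (i) / Cor 4.5 at GENUINE bases by print's route: the tripod, arithmetic curves, `ℂ ∖ F`, `E ∖ {x₀}`

S. Mochizuki, *Topics in absolute anabelian geometry III*, proof of Prop 4.2 (i) p. 106 l. 11–19 (kurims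
`paper:url-5493eb38cbb7`; bib key `MochizukiAbsTopIII2015`): «for any object `X` of `EA`, the full
subcategory of `EA` consisting of objects that map to `X` may … be identified with the category of finite
étale R-localizations `Loc_R(X)` … Thus, the id-rigidity of `EA` follows immediately from the slimness
assertion of Lemma 4.3»; Cor 4.5 (i)–(v) pp. 107–109.

PROOF-ONLY coda (no definition, no named fact) composing, BY NAME: abc-iut-L4-t14's `hfin`-free columns
(`…PSLHfinFree`, `…RCPSLHfinFree`: residual `hN`, resp. (P)+(FC) in the punctured case); abc-iut-L4-d1's
`…PSLArithmeticCusps` ((P), (FC) and `[N(Λ̄) : Λ̄] < ∞` for every ARITHMETIC `Γ̄`) and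
`…PSLGammaTwoUniformisation` (`ℍ/Γ̄(2)` IS the tripod via the modular `λ`-function: `Γ̄(2)` acts freely and
properly discontinuously, `Γ̄(2) ≃* F₂`, `pslQuotient Γ̄(2) ≅ planeComplFinite {0,1}` with the transport
equalities); abc-iut-L4-t12's `isArithmetic_map_comap_of_subgroup_SL2Z`; abc-iut-w6-d031's uniformised-base
junctions `exists_pslQuotient_iso_planeComplFinite_freeGroup` / `…_puncturedTorus_freeGroup`.

* ★★ `HolRS.isIdRigid_EA_mapsTo_pslQuotient_of_isArithmetic_hfinFree` (+ RC twin, + Cor 4.5 ×2) — for EVERY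
  arithmetic `Γ̄ ≤ PSL₂(ℝ)`, free-or-surface, non-abelian, acting freely and properly discontinuously:
  the geometric `EA` over `ℍ/Γ̄` is ID-RIGID in both morphism classes — NO residual hypothesis (cusps from
  arithmeticity, no `hfin`);
* ★★★ `HolRS.isIdRigid_EA_mapsTo_tripod` — **AT THE TRIPOD `ℙ¹ ∖ {0, 1, ∞}` (IUT's `X_v`-type (0,3) base),
  with ZERO hypotheses: the geometric `EA` of connected Riemann surfaces mapping to `ℂ ∖ {0,1}` is ID-RIGID,
  for holomorphic AND for print-faithful RC morphisms, and [AbsTopIII] Cor 4.5 (i)–(v) holds for the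
  archimedean log-Frobenius data over both** — print's own route, kernel-closed end to end;
* ★★ `HolRS.isIdRigid_EA_mapsTo_planeComplFinite_of_hN`, `HolRS.isIdRigid_EA_mapsTo_puncturedTorus_of_hN` —
  abc-iut-w6-d031's genuine-base theorems for `ℂ ∖ F` (`2 ≤ |F|`) and the once-punctured elliptic curve
  `E ∖ {x₀}` UPGRADED: the binder `hfin` is gone; residual = `hN : [N(Λ̄') : Λ̄'] < ∞` ONLY, and the
  conclusion now includes the EA-level RC statement and Cor 4.5 in both classes.

HONEST SCOPE: MODEL side of [AbsTopIII] §4 — a genuine Riemann surface sits at `X₀`, but the functor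
`EA → (groups)` of print (reconstruction) is not the object here (model ≠ reconstruction); orbi objects and
`EA` over ALL hyperbolic bases simultaneously untouched; for non-arithmetic `ℂ ∖ F` (`|F| ≥ 3`) and
`E ∖ {x₀}` the cusp data (P)+(FC) of the deck group («punctures are cusps») is NOT derived here.
Classical; nothing here bears on [IUTchIII] Cor. 3.12.
-/

set_option autoImplicit false

noncomputable section

open scoped Manifold ContDiff Topology UpperHalfPlane MatrixGroups Matrix
open _root_.MulAction _root_.CategoryTheory
open Literature.AlgebraicGeometry.Frobenioids (IsSlimGroup)
open Literature.IUT.HodgeTheaters (IsFreeOrSurface)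
open Matrix.SpecialLinearGroup (toGL)
open Matrix.ProjectiveSpecialLinearGroup (toPGL)
open Literature.Geometry.Kaehler (ComplexTorus)

namespace Literature.AnabelianGeometry.AbsoluteAnabelian

namespace HolRS

/-! ### §1 Every arithmetic base: no residual hypothesis -/

section Arithmetic

variable (Γ : Subgroup PSL2R) [ProperlyDiscontinuousSMul Γ ℍ] [IsCancelSMul Γ ℍ]

/-- ★★ **[AbsTopIII] Prop 4.2 (i) at `X₀ = ℍ/Γ̄` for EVERY ARITHMETIC `Γ̄`** (free of finite rank or an
orientable surface group, non-abelian, acting freely and properly discontinuously): the geometric `EA` is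
ID-RIGID — no residual hypothesis ((P)+(FC) from arithmeticity, abc-iut-L4-d1; no `hfin`, abc-iut-L4-t14).
[cite: MochizukiAbsTopIII2015, Proposition 4.2 (i) proof p.106] -/
theorem isIdRigid_EA_mapsTo_pslQuotient_of_isArithmetic_hfinFree
    [((Γ.comap (QuotientGroup.mk' (Subgroup.center SL(2, ℝ)))).map
      (toGL : SL(2, ℝ) →* GL (Fin 2) ℝ)).IsArithmetic]
    (hΓ : IsFreeOrSurface Γ) (hab : ∃ a b : Γ, a * b ≠ b * a) :
    Literature.AnabelianGeometry.AbsoluteAnabelian.IsIdRigid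
      (HolRS.geometricAutHolFieldFunctor fun Y : HolRS => Nonempty (Y ⟶ HolRS.pslQuotient Γ)).EA :=
  isIdRigid_EA_mapsTo_pslQuotient_of_cusps_hfinFree Γ hΓ hab (exists_parabolic_of_isArithmetic Γ)
    (exists_finset_cusps_of_isArithmetic Γ)

/-- ★★ **Cor 4.5 (i)–(v) at `X₀ = ℍ/Γ̄` for every ARITHMETIC `Γ̄`** (same structure; no residual
hypothesis). [cite: MochizukiAbsTopIII2015, Corollary 4.5 pp.107–109] -/
theorem cor_4_5_geometric_mapsTo_pslQuotient_of_isArithmetic_hfinFree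
    [((Γ.comap (QuotientGroup.mk' (Subgroup.center SL(2, ℝ)))).map
      (toGL : SL(2, ℝ) →* GL (Fin 2) ℝ)).IsArithmetic]
    (hΓ : IsFreeOrSurface Γ) (hab : ∃ a b : Γ, a * b ≠ b * a) :
    Literature.AnabelianGeometry.AbsoluteAnabelian.AbsTopIII.Cor_4_5
      (Literature.AnabelianGeometry.AbsoluteAnabelian.archLogFrobeniusData
        (HolRS.geometricAutHolFieldFunctor fun Y : HolRS => Nonempty (Y ⟶ HolRS.pslQuotient Γ)))
      (Literature.AnabelianGeometry.AbsoluteAnabelian.archTelecoreData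
        (HolRS.geometricAutHolFieldFunctor fun Y : HolRS => Nonempty (Y ⟶ HolRS.pslQuotient Γ))) :=
  cor_4_5_geometric_mapsTo_pslQuotient_of_cusps_hfinFree Γ hΓ hab (exists_parabolic_of_isArithmetic Γ)
    (exists_finset_cusps_of_isArithmetic Γ)

/-- ★★ **Print-faithful (RC) morphisms, every ARITHMETIC `Γ̄`**: the geometric `EA` of the RC instance over
`ℍ/Γ̄` is ID-RIGID — no residual hypothesis. [cite: MochizukiAbsTopIII2015, Proposition 4.2 (i) proof p.106] -/
theorem RC.isIdRigid_EA_mapsTo_pslQuotient_of_isArithmetic_hfinFree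
    [((Γ.comap (QuotientGroup.mk' (Subgroup.center SL(2, ℝ)))).map
      (toGL : SL(2, ℝ) →* GL (Fin 2) ℝ)).IsArithmetic]
    (hΓ : IsFreeOrSurface Γ) (hab : ∃ a b : Γ, a * b ≠ b * a) :
    Literature.AnabelianGeometry.AbsoluteAnabelian.IsIdRigid
      (HolRS.geometricAutHolFieldFunctorRC fun Y : RC =>
        Nonempty (Y ⟶ HolRS.toRC.obj (HolRS.pslQuotient Γ))).EA :=
  RC.isIdRigid_EA_mapsTo_pslQuotient_of_cusps_hfinFree Γ hΓ hab (exists_parabolic_of_isArithmetic Γ)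
    (exists_finset_cusps_of_isArithmetic Γ)

/-- ★★ **Cor 4.5 (i)–(v), print-faithful morphisms, every ARITHMETIC `Γ̄`** — no residual hypothesis.
[cite: MochizukiAbsTopIII2015, Corollary 4.5 pp.107–109] -/
theorem RC.cor_4_5_geometric_mapsTo_pslQuotient_of_isArithmetic_hfinFree
    [((Γ.comap (QuotientGroup.mk' (Subgroup.center SL(2, ℝ)))).map
      (toGL : SL(2, ℝ) →* GL (Fin 2) ℝ)).IsArithmetic]
    (hΓ : IsFreeOrSurface Γ) (hab : ∃ a b : Γ, a * b ≠ b * a) :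
    Literature.AnabelianGeometry.AbsoluteAnabelian.AbsTopIII.Cor_4_5
      (Literature.AnabelianGeometry.AbsoluteAnabelian.archLogFrobeniusData
        (HolRS.geometricAutHolFieldFunctorRC fun Y : RC =>
          Nonempty (Y ⟶ HolRS.toRC.obj (HolRS.pslQuotient Γ))))
      (Literature.AnabelianGeometry.AbsoluteAnabelian.archTelecoreData
        (HolRS.geometricAutHolFieldFunctorRC fun Y : RC =>
          Nonempty (Y ⟶ HolRS.toRC.obj (HolRS.pslQuotient Γ)))) :=
  RC.cor_4_5_geometric_mapsTo_pslQuotient_of_cusps_hfinFree Γ hΓ hab (exists_parabolic_of_isArithmetic Γ)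
    (exists_finset_cusps_of_isArithmetic Γ)

end Arithmetic

/-! ### §2 The tripod `ℙ¹ ∖ {0, 1, ∞} = ℍ/Γ̄(2)`: zero hypotheses -/

/-- ★★★ **[AbsTopIII] Prop 4.2 (i) and Cor 4.5 (i)–(v) AT THE TRIPOD `ℙ¹ ∖ {0, 1, ∞}`, ZERO hypotheses,
both morphism classes**, by print's route: `ℂ ∖ {0,1} ≅ ℍ/Γ̄(2)` (abc-iut-L4-d1, modular `λ`), `Γ̄(2) ≃* F₂`
acting freely and properly discontinuously, arithmetic (abc-iut-L4-t12) hence cusped with finitely many cusp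
classes (abc-iut-L4-d1), so the `hfin`-free punctured column fires: (1) the geometric `EA` of connected
Riemann surfaces mapping holomorphically-finite-étale to `ℂ ∖ {0,1}` is ID-RIGID; (2) Cor 4.5 holds for its
archimedean log-Frobenius data; (3)–(4) the same for print-faithful RC morphisms.
[cite: MochizukiAbsTopIII2015, Proposition 4.2 (i) proof p.106] [cite: MochizukiAbsTopIII2015, Corollary 4.5 pp.107–109] -/
theorem isIdRigid_EA_mapsTo_tripod :
    Literature.AnabelianGeometry.AbsoluteAnabelian.IsIdRigid
        (HolRS.geometricAutHolFieldFunctor fun Y : HolRS =>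
          Nonempty (Y ⟶ planeComplFinite ({0, 1} : Set ℂ) (Set.toFinite _))).EA ∧
      Literature.AnabelianGeometry.AbsoluteAnabelian.AbsTopIII.Cor_4_5
        (Literature.AnabelianGeometry.AbsoluteAnabelian.archLogFrobeniusData
          (HolRS.geometricAutHolFieldFunctor fun Y : HolRS =>
            Nonempty (Y ⟶ planeComplFinite ({0, 1} : Set ℂ) (Set.toFinite _))))
        (Literature.AnabelianGeometry.AbsoluteAnabelian.archTelecoreData
          (HolRS.geometricAutHolFieldFunctor fun Y : HolRS =>
            Nonempty (Y ⟶ planeComplFinite ({0, 1} : Set ℂ) (Set.toFinite _)))) ∧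
      Literature.AnabelianGeometry.AbsoluteAnabelian.IsIdRigid
        (HolRS.geometricAutHolFieldFunctorRC fun Y : RC =>
          Nonempty (Y ⟶ toRC.obj (planeComplFinite ({0, 1} : Set ℂ) (Set.toFinite _)))).EA ∧
      Literature.AnabelianGeometry.AbsoluteAnabelian.AbsTopIII.Cor_4_5
        (Literature.AnabelianGeometry.AbsoluteAnabelian.archLogFrobeniusData
          (HolRS.geometricAutHolFieldFunctorRC fun Y : RC =>
            Nonempty (Y ⟶ toRC.obj (planeComplFinite ({0, 1} : Set ℂ) (Set.toFinite _)))))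
        (Literature.AnabelianGeometry.AbsoluteAnabelian.archTelecoreData
          (HolRS.geometricAutHolFieldFunctorRC fun Y : RC =>
            Nonempty (Y ⟶ toRC.obj (planeComplFinite ({0, 1} : Set ℂ) (Set.toFinite _))))) := by
  obtain ⟨hPD, hC, -, hH, hR⟩ := exists_pslQuotient_pslGamma_two_iso_planeComplFinite
  haveI := hPD
  haveI := hC
  haveI := isArithmetic_map_comap_of_subgroup_SL2Z (CongruenceSubgroup.Gamma 2)
  obtain ⟨e⟩ := nonempty_pslGamma_two_mulEquiv_freeGroup
  have hΓ : IsFreeOrSurface (((CongruenceSubgroup.Gamma 2).map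
      (Matrix.SpecialLinearGroup.map (Int.castRingHom ℝ))).map
        (QuotientGroup.mk' (Subgroup.center SL(2, ℝ)))) := Or.inl ⟨2, ⟨e⟩⟩
  have hab := exists_mul_ne_mul_pslGamma_two
  refine ⟨?_, ?_, ?_, ?_⟩
  · have h := isIdRigid_EA_mapsTo_pslQuotient_of_isArithmetic_hfinFree _ hΓ hab
    rw [hH] at h
    exact h
  · have h := cor_4_5_geometric_mapsTo_pslQuotient_of_isArithmetic_hfinFree _ hΓ hab
    rw [hH] at h
    exact h
  · have h := RC.isIdRigid_EA_mapsTo_pslQuotient_of_isArithmetic_hfinFree _ hΓ hab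
    rw [hR] at h
    exact h
  · have h := RC.cor_4_5_geometric_mapsTo_pslQuotient_of_isArithmetic_hfinFree _ hΓ hab
    rw [hR] at h
    exact h

/-- ★★★ **The geometric `EA` of connected Riemann surfaces mapping to the tripod `ℙ¹ ∖ {0, 1, ∞}` is
ID-RIGID — ZERO hypotheses** (statement shape and name as in abc-iut-L4-d1 g6's staged `…PSLTripod.lean`,
withdrawn in favour of this coda; here by the `hfin`-free route). [cite: MochizukiAbsTopIII2015, Proposition 4.2 (i) proof p.106] -/
theorem isIdRigid_EA_mapsTo_thricePuncturedSphere :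
    Literature.AnabelianGeometry.AbsoluteAnabelian.IsIdRigid (HolRS.geometricAutHolFieldFunctor
      fun Y : HolRS => Nonempty (Y ⟶ planeComplFinite ({0, 1} : Set ℂ) (Set.toFinite _))).EA :=
  isIdRigid_EA_mapsTo_tripod.1

/-- ★★★ **[AbsTopIII] Cor 4.5 (i)–(v) over the tripod — ZERO hypotheses.**
[cite: MochizukiAbsTopIII2015, Corollary 4.5 pp.107–109] -/
theorem cor_4_5_geometric_mapsTo_thricePuncturedSphere :
    Literature.AnabelianGeometry.AbsoluteAnabelian.AbsTopIII.Cor_4_5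
      (Literature.AnabelianGeometry.AbsoluteAnabelian.archLogFrobeniusData
        (HolRS.geometricAutHolFieldFunctor fun Y : HolRS =>
          Nonempty (Y ⟶ planeComplFinite ({0, 1} : Set ℂ) (Set.toFinite _))))
      (Literature.AnabelianGeometry.AbsoluteAnabelian.archTelecoreData
        (HolRS.geometricAutHolFieldFunctor fun Y : HolRS =>
          Nonempty (Y ⟶ planeComplFinite ({0, 1} : Set ℂ) (Set.toFinite _)))) :=
  isIdRigid_EA_mapsTo_tripod.2.1

/-- ★★★ **Print-faithful (RC) morphisms: the geometric `EA` of the RC instance over the tripod is ID-RIGID —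
ZERO hypotheses.** [cite: MochizukiAbsTopIII2015, Proposition 4.2 (i) proof p.106] -/
theorem RC.isIdRigid_EA_mapsTo_thricePuncturedSphere :
    Literature.AnabelianGeometry.AbsoluteAnabelian.IsIdRigid (HolRS.geometricAutHolFieldFunctorRC
      fun Y : RC => Nonempty (Y ⟶ toRC.obj (planeComplFinite ({0, 1} : Set ℂ) (Set.toFinite _)))).EA :=
  isIdRigid_EA_mapsTo_tripod.2.2.1

/-- ★★★ **[AbsTopIII] Cor 4.5 (i)–(v), print-faithful morphisms, over the tripod — ZERO hypotheses.**
[cite: MochizukiAbsTopIII2015, Corollary 4.5 pp.107–109] -/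
theorem RC.cor_4_5_geometric_mapsTo_thricePuncturedSphere :
    Literature.AnabelianGeometry.AbsoluteAnabelian.AbsTopIII.Cor_4_5
      (Literature.AnabelianGeometry.AbsoluteAnabelian.archLogFrobeniusData
        (HolRS.geometricAutHolFieldFunctorRC fun Y : RC =>
          Nonempty (Y ⟶ toRC.obj (planeComplFinite ({0, 1} : Set ℂ) (Set.toFinite _)))))
      (Literature.AnabelianGeometry.AbsoluteAnabelian.archTelecoreData
        (HolRS.geometricAutHolFieldFunctorRC fun Y : RC =>
          Nonempty (Y ⟶ toRC.obj (planeComplFinite ({0, 1} : Set ℂ) (Set.toFinite _))))) :=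
  isIdRigid_EA_mapsTo_tripod.2.2.2

/-! ### §3 `ℂ ∖ F` (`2 ≤ |F|`) and `E ∖ {x₀}`: residual = `Aut` finiteness only -/

/-- ★★ **[AbsTopIII] Prop 4.2 (i) and Cor 4.5 at the genuine `X = ℂ ∖ F`** (`2 ≤ |F| < ∞`), print's route,
abc-iut-w6-d031's `isIdRigid_EA_mapsTo_planeComplFinite_of_finiteness` UPGRADED: the binder `hfin` is GONE
(abc-iut-L4-t14's `hfin`-free columns) — residual = `hN : [N(Λ̄') : Λ̄'] < ∞` for the finite-index subgroups
of the Möbius deck group `Λ̄ ≅ F_{|F|}` ONLY — and the conclusion carries BOTH morphism classes at the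
`EA` level with Cor 4.5. [cite: MochizukiAbsTopIII2015, Proposition 4.2 (i) proof p.106]
[cite: MochizukiAbsTopIII2015, Corollary 4.5 pp.107–109] -/
theorem isIdRigid_EA_mapsTo_planeComplFinite_of_hN {F : Set ℂ} (hF : F.Finite) (h2 : 2 ≤ F.ncard) :
    ∃ (Λ : Subgroup PSL2R) (_ : ProperlyDiscontinuousSMul Λ ℍ) (_ : IsCancelSMul Λ ℍ),
      Nonempty (Λ ≃* FreeGroup (Fin F.ncard)) ∧ Nonempty (pslQuotient Λ ≅ planeComplFinite F hF) ∧
      ((∀ Λ' : _root_.Literature.AnabelianGeometry.AbsoluteAnabelian.LocObj Λ,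
          (Λ'.toSubgroup.subgroupOf (Subgroup.normalizer (Λ'.toSubgroup : Set PSL2R))).FiniteIndex) →
        Literature.AnabelianGeometry.AbsoluteAnabelian.IsIdRigid (HolRS.geometricAutHolFieldFunctor
            fun Y : HolRS => Nonempty (Y ⟶ planeComplFinite F hF)).EA ∧
          Literature.AnabelianGeometry.AbsoluteAnabelian.AbsTopIII.Cor_4_5
            (Literature.AnabelianGeometry.AbsoluteAnabelian.archLogFrobeniusData
              (HolRS.geometricAutHolFieldFunctor fun Y : HolRS => Nonempty (Y ⟶ planeComplFinite F hF)))
            (Literature.AnabelianGeometry.AbsoluteAnabelian.archTelecoreData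
              (HolRS.geometricAutHolFieldFunctor fun Y : HolRS => Nonempty (Y ⟶ planeComplFinite F hF))) ∧
          Literature.AnabelianGeometry.AbsoluteAnabelian.IsIdRigid (HolRS.geometricAutHolFieldFunctorRC
            fun Y : RC => Nonempty (Y ⟶ toRC.obj (planeComplFinite F hF))).EA ∧
          Literature.AnabelianGeometry.AbsoluteAnabelian.AbsTopIII.Cor_4_5
            (Literature.AnabelianGeometry.AbsoluteAnabelian.archLogFrobeniusData
              (HolRS.geometricAutHolFieldFunctorRC
                fun Y : RC => Nonempty (Y ⟶ toRC.obj (planeComplFinite F hF))))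
            (Literature.AnabelianGeometry.AbsoluteAnabelian.archTelecoreData
              (HolRS.geometricAutHolFieldFunctorRC
                fun Y : RC => Nonempty (Y ⟶ toRC.obj (planeComplFinite F hF))))) := by
  obtain ⟨-, Λ, hPD, hC, -, -, -, ⟨e⟩, hiso, hH, hR⟩ :=
    exists_pslQuotient_iso_planeComplFinite_freeGroup hF h2
  have hΓ : IsFreeOrSurface Λ := Or.inl ⟨_, ⟨e⟩⟩
  have hab : ∃ a b : Λ, a * b ≠ b * a :=
    Literature.GroupTheory.exists_mul_ne_mul_of_mulEquiv e
      (Literature.GroupTheory.FreeGroup.exists_mul_ne_mul_fin h2)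
  refine ⟨Λ, hPD, hC, ⟨e⟩, hiso, fun hN => ⟨?_, ?_, ?_, ?_⟩⟩
  · have h := isIdRigid_EA_mapsTo_pslQuotient_of_isFreeOrSurface_hfinFree Λ hΓ hab hN
    rw [hH] at h
    exact h
  · have h := cor_4_5_geometric_mapsTo_pslQuotient_of_isFreeOrSurface_hfinFree Λ hΓ hab hN
    rw [hH] at h
    exact h
  · have h := RC.isIdRigid_EA_mapsTo_pslQuotient_of_isFreeOrSurface_hfinFree Λ hΓ hab hN
    rw [hR] at h
    exact h
  · have h := RC.cor_4_5_geometric_mapsTo_pslQuotient_of_isFreeOrSurface_hfinFree Λ hΓ hab hN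
    rw [hR] at h
    exact h

/-- ★★ **[AbsTopIII] Prop 4.2 (i) and Cor 4.5 at the genuine once-punctured elliptic curve `E ∖ {x₀}`**
(`E = ℂ/Φ(ℤ²)`; IUT's `X_v` of type `(1,1)`), print's route, abc-iut-w6-d031's
`isIdRigid_EA_mapsTo_puncturedTorus_of_finiteness` UPGRADED: `hfin` GONE — residual = `hN` for the
finite-index subgroups of the Möbius deck group `Λ̄ ≅ F₂` ONLY (the cusp data (P)+(FC) of `Λ̄`, «the puncture
is a cusp», would discharge it: `…_of_cusps_hfinFree`) — both morphism classes at the `EA` level with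
Cor 4.5. [cite: MochizukiAbsTopIII2015, Proposition 4.2 (i) proof p.106]
[cite: MochizukiAbsTopIII2015, Corollary 4.5 pp.107–109] -/
theorem isIdRigid_EA_mapsTo_puncturedTorus_of_hN (Φ : (Fin 2 → ℝ) ≃L[ℝ] ℂ) (x₀ : ComplexTorus Φ) :
    ∃ (Λ : Subgroup PSL2R) (_ : ProperlyDiscontinuousSMul Λ ℍ) (_ : IsCancelSMul Λ ℍ),
      Nonempty (Λ ≃* FreeGroup (Fin 2)) ∧ Nonempty (pslQuotient Λ ≅ puncturedTorus Φ x₀) ∧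
      ((∀ Λ' : _root_.Literature.AnabelianGeometry.AbsoluteAnabelian.LocObj Λ,
          (Λ'.toSubgroup.subgroupOf (Subgroup.normalizer (Λ'.toSubgroup : Set PSL2R))).FiniteIndex) →
        Literature.AnabelianGeometry.AbsoluteAnabelian.IsIdRigid (HolRS.geometricAutHolFieldFunctor
            fun Y : HolRS => Nonempty (Y ⟶ puncturedTorus Φ x₀)).EA ∧
          Literature.AnabelianGeometry.AbsoluteAnabelian.AbsTopIII.Cor_4_5
            (Literature.AnabelianGeometry.AbsoluteAnabelian.archLogFrobeniusData
              (HolRS.geometricAutHolFieldFunctor fun Y : HolRS => Nonempty (Y ⟶ puncturedTorus Φ x₀)))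
            (Literature.AnabelianGeometry.AbsoluteAnabelian.archTelecoreData
              (HolRS.geometricAutHolFieldFunctor fun Y : HolRS => Nonempty (Y ⟶ puncturedTorus Φ x₀))) ∧
          Literature.AnabelianGeometry.AbsoluteAnabelian.IsIdRigid (HolRS.geometricAutHolFieldFunctorRC
            fun Y : RC => Nonempty (Y ⟶ toRC.obj (puncturedTorus Φ x₀))).EA ∧
          Literature.AnabelianGeometry.AbsoluteAnabelian.AbsTopIII.Cor_4_5
            (Literature.AnabelianGeometry.AbsoluteAnabelian.archLogFrobeniusData
              (HolRS.geometricAutHolFieldFunctorRC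
                fun Y : RC => Nonempty (Y ⟶ toRC.obj (puncturedTorus Φ x₀))))
            (Literature.AnabelianGeometry.AbsoluteAnabelian.archTelecoreData
              (HolRS.geometricAutHolFieldFunctorRC
                fun Y : RC => Nonempty (Y ⟶ toRC.obj (puncturedTorus Φ x₀))))) := by
  obtain ⟨-, Λ, hPD, hC, -, -, -, ⟨e⟩, hiso, hH, hR⟩ :=
    exists_pslQuotient_iso_puncturedTorus_freeGroup Φ x₀
  have hΓ : IsFreeOrSurface Λ := Or.inl ⟨_, ⟨e⟩⟩
  have hab : ∃ a b : Λ, a * b ≠ b * a :=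
    Literature.GroupTheory.exists_mul_ne_mul_of_mulEquiv e
      (Literature.GroupTheory.FreeGroup.exists_mul_ne_mul_fin le_rfl)
  refine ⟨Λ, hPD, hC, ⟨e⟩, hiso, fun hN => ⟨?_, ?_, ?_, ?_⟩⟩
  · have h := isIdRigid_EA_mapsTo_pslQuotient_of_isFreeOrSurface_hfinFree Λ hΓ hab hN
    rw [hH] at h
    exact h
  · have h := cor_4_5_geometric_mapsTo_pslQuotient_of_isFreeOrSurface_hfinFree Λ hΓ hab hN
    rw [hH] at h
    exact h
  · have h := RC.isIdRigid_EA_mapsTo_pslQuotient_of_isFreeOrSurface_hfinFree Λ hΓ hab hN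
    rw [hR] at h
    exact h
  · have h := RC.cor_4_5_geometric_mapsTo_pslQuotient_of_isFreeOrSurface_hfinFree Λ hΓ hab hN
    rw [hR] at h
    exact h

end HolRS

end Literature.AnabelianGeometry.AbsoluteAnabelian

end
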